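import Summits.QuantumFields.YangMills.Theorems.AllWindowsColdBoxBoxHighLineSmearedFPOrbitLocalisation
import Summits.QuantumFields.YangMills.Theorems.AllWindowsColdBoxBoxHighLineSmearedFPPauli
import Summits.QuantumFields.YangMills.Theorems.AllWindowsColdBoxBoxHighLinePauliChartComparison
import Summits.QuantumFields.YangMills.Theorems.AllWindowsColdBoxBoxHighLineLandauBallCoercivity

/-!
# T-S5.4p `BulkCutoffOne` and T-S5.4q `FarRegionPhiLower` — the two region glue pieces of STEP1c §2 in PAULI letters

Planner ym-idea-2 g17, bus `ym-idea-2/INBOX.md` 2026-08-29T17:43:40Z («4p + 4q → w5, one file, state the Props yourself from the landed lemmas»);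
`Cruxes/BoxWindowHighSU2213/STUB-PLAN-S5U5-STEP1c.md` §2, for the XL comparison stubs S5 (LINE-19 ⟨stmt-QuantumFields-24004⟩/⟨24335⟩) and U5
(LINE-20 ⟨24336⟩).  In the Pauli chart `A : interiorSites → ℝ³ ↦ pauliGauge H A = extendGauge H (expPauli ∘ A)` (✓T-S5.4b, `…SmearedFPPauli`):

* (4p) **`BulkCutoffOne`** — the (bulk-low) cut-off clause: if every box link of `V` has defect `≤ r₀²` and `‖A x‖ ≤ ρ ≤ π` at every interior
  site, then `ballCutoff H r (V^{pauliGauge H A}) = 1` as soon as `r₀ + 2ρ ≤ r` (`0 < r`); with the companion **`BulkLinkDefect`**: every box link of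
  `V^{pauliGauge H A}` has defect `≤ (r₀ + 2ρ)²` — the hypothesis shape of ✓T-S5.4ℓ.  (✓`ballCutoff_gaugeTransformZd_eq_one_of_near_one`,
  ✓`linkDefect_gaugeTransformZd_le_of_near_one` of w2 g30's `…SmearedFPOrbitLocalisation`, read through ✓T-S5.4j `pauliChartComparison`:
  `‖q(expPauli a) − 1‖ ≤ ‖a‖` for `‖a‖ ≤ π`.)
* (4q) **`FarRegionPhiLower`** — the far piece (ii): if `V` is in lattice Landau gauge with box links in the `r₀`-ball, `‖A x‖ ≤ ρ₁ ≤ π` at every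
  interior site, `(r₀ + 2ρ₁)·H ≤ c₀`, and SOME interior site has `δ₁ ≤ ‖A x₀‖`, then `c·δ₁² ≤ H⁴ · landauPhi H (V^{pauliGauge H A})` — ✓T-S5.4ℓ
  `landauBallCoercivity` with `U := V`, `g := 1`, `g' := pauliGauge H A` (its `c₀`, and `c = c_ℓ·(2/π)²` from the lower half of ✓4j,
  `(2/π)‖a‖ ≤ ‖q(expPauli a) − 1‖`); the proof of ✓4ℓ gives `c₀ = 1/32`, `c = (1/128)(2/π)²`, the statement keeps the constants existential as ✓4ℓ does.

Tree (✓…SmearedFPOrbitLocalisation, ✓…SmearedFPPauli, ✓…PauliChartComparison, ✓…LandauBallCoercivity) + Mathlib; the only definitions are the three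
Props; standard axioms.  HONEST LABEL: glue of step (1c) of the XL stubs S5/U5; T-S5.4 proper, S5, U5 and the cruxes ⟨24004⟩ ⟨24335⟩ ⟨24336⟩ remain
OPEN; no summit is proved; the Yang–Mills mass gap is NOT proved by this file.  Seat ym-line-sfw-p2-w5 g21 (cell ym-idea-1).
-/

set_option autoImplicit false

noncomputable section

open Finset
open Literature.MathematicalPhysics.QuantumFieldTheory.AxialGauge (boxEdges)
open Literature.MathematicalPhysics.QuantumFieldTheory.Balaban1983to89.B10Eq18SigmaSU2Haar (expPauli)
open Literature.MathematicalPhysics.QuantumLattice (su2Quat norm_su2Quat gaugeTransformZd LGConfig ZdEdge)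
open Literature.Probability.LatticeModels (Site)
open Summit.QuantumFields.YangMills.Theorems.AllWindowsColdBoxBoxHighLine.LandauBall (linkDefect_eq_norm_sq)

namespace Summit.QuantumFields.YangMills.Theorems.AllWindowsColdBoxBoxHighLine

/-! ## The Props -/

/-- T-S5.4p **`BulkCutoffOne`**: on the sup-box `{∀ x, ‖A x‖ ≤ ρ}` (`ρ ≤ π`) around a configuration `V` whose box links lie in the `r₀`-ball,
the ball cut-off of `V^{pauliGauge H A}` is identically `1` whenever `r₀ + 2ρ ≤ r`, `0 < r`. -/
def BulkCutoffOne : Prop :=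
  ∀ (H : ℕ) (r₀ ρ r : ℝ), 0 ≤ r₀ → 0 ≤ ρ → ρ ≤ Real.pi → 0 < r → r₀ + 2 * ρ ≤ r →
    ∀ (V : LGConfig 4 SU2) (A : ↥(interiorSites H) → EuclideanSpace ℝ (Fin 3)),
      (∀ e ∈ boxEdges 4 (2 * H + 1), linkDefect V e ≤ r₀ ^ 2) → (∀ x, ‖A x‖ ≤ ρ) →
        ballCutoff H r (gaugeTransformZd (pauliGauge H A) V) = 1

/-- Companion of 4p **`BulkLinkDefect`**: under the same hypotheses every box link of `V^{pauliGauge H A}` has defect `≤ (r₀ + 2ρ)²`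
(the hypothesis shape of ✓T-S5.4ℓ `LandauBallCoercivity`). -/
def BulkLinkDefect : Prop :=
  ∀ (H : ℕ) (r₀ ρ : ℝ), 0 ≤ r₀ → 0 ≤ ρ → ρ ≤ Real.pi →
    ∀ (V : LGConfig 4 SU2) (A : ↥(interiorSites H) → EuclideanSpace ℝ (Fin 3)),
      (∀ e ∈ boxEdges 4 (2 * H + 1), linkDefect V e ≤ r₀ ^ 2) → (∀ x, ‖A x‖ ≤ ρ) →
        ∀ e ∈ boxEdges 4 (2 * H + 1), linkDefect (gaugeTransformZd (pauliGauge H A) V) e ≤ (r₀ + 2 * ρ) ^ 2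

/-- T-S5.4q **`FarRegionPhiLower`**: there are `c₀, c > 0` such that for `H ≥ 1`, a configuration `V` in lattice Landau gauge with box links in
the `r₀`-ball, and Pauli coordinates `A` with `‖A x‖ ≤ ρ₁ ≤ π` everywhere, `(r₀ + 2ρ₁)·H ≤ c₀`, and `0 ≤ δ₁ ≤ ‖A x₀‖` at SOME interior site,
`c·δ₁² ≤ H⁴ · landauPhi H (V^{pauliGauge H A})` (the FAR-region lower bound on the gauge-fixing functional). -/
def FarRegionPhiLower : Prop :=
  ∃ c₀ c : ℝ, 0 < c₀ ∧ 0 < c ∧ ∀ H : ℕ, 1 ≤ H → ∀ r₀ ρ₁ δ₁ : ℝ, 0 ≤ r₀ → 0 ≤ ρ₁ → ρ₁ ≤ Real.pi → 0 ≤ δ₁ → (r₀ + 2 * ρ₁) * H ≤ c₀ →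
    ∀ (V : LGConfig 4 SU2) (A : ↥(interiorSites H) → EuclideanSpace ℝ (Fin 3)),
      (∀ e ∈ boxEdges 4 (2 * H + 1), linkDefect V e ≤ r₀ ^ 2) → InLandauGauge H V → (∀ x, ‖A x‖ ≤ ρ₁) →
      (∃ x₀, δ₁ ≤ ‖A x₀‖) →
        c * δ₁ ^ 2 ≤ (H : ℝ) ^ 4 * landauPhi H (gaugeTransformZd (pauliGauge H A) V)

/-! ## Pauli-chart bookkeeping -/

namespace PauliRegions

/-- `pauliGauge H A` at an interior site. -/
theorem pauliGauge_of_mem {H : ℕ} (A : ↥(interiorSites H) → EuclideanSpace ℝ (Fin 3)) {x : Site 4} (hx : x ∈ interiorSites H) :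
    pauliGauge H A x = expPauli (A ⟨x, hx⟩) :=
  extendGauge_of_mem _ hx

/-- `pauliGauge H A` off the interior. -/
theorem pauliGauge_of_not_mem {H : ℕ} (A : ↥(interiorSites H) → EuclideanSpace ℝ (Fin 3)) {x : Site 4} (hx : x ∉ interiorSites H) :
    pauliGauge H A x = 1 :=
  extendGauge_of_not_mem _ hx

/-- **The sup-box is a near-identity ball in quaternion distance**: `‖q(pauliGauge H A x) − 1‖ ≤ ρ` at every site if `‖A x‖ ≤ ρ ≤ π` on the
interior (upper half of ✓T-S5.4j). -/
theorem norm_su2Quat_pauliGauge_sub_one_le {H : ℕ} {A : ↥(interiorSites H) → EuclideanSpace ℝ (Fin 3)} {ρ : ℝ} (hρ : 0 ≤ ρ)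
    (hρπ : ρ ≤ Real.pi) (hA : ∀ x, ‖A x‖ ≤ ρ) (x : Site 4) : ‖su2Quat (pauliGauge H A x) - 1‖ ≤ ρ := by
  by_cases hx : x ∈ interiorSites H
  · rw [pauliGauge_of_mem A hx]
    exact (pauliChartComparison (A ⟨x, hx⟩) ((hA _).trans hρπ)).2.trans (hA _)
  · rw [pauliGauge_of_not_mem A hx, FemtoTransferGap.su2Quat_one, sub_self, norm_zero]
    exact hρ

/-- The trivial gauge transformation acts trivially. -/
theorem gaugeTransformZd_one_eq_self (V : LGConfig 4 SU2) : gaugeTransformZd (1 : Site 4 → SU2) V = V := by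
  funext e
  simp [gaugeTransformZd]

/-- `1` is an interior gauge transformation. -/
theorem isInteriorGauge_one (H : ℕ) : IsInteriorGauge H (1 : Site 4 → SU2) := fun _ _ => rfl

/-- The gauge distance is nonnegative (`= ‖q(g'_x g_x⁻¹) − 1‖²`). -/
theorem gaugeDist_nonneg (g g' : Site 4 → SU2) (x : Site 4) : 0 ≤ gaugeDist g g' x := by
  have hd : gaugeDist g g' x = ‖su2Quat (g' x * (g x)⁻¹) - 1‖ ^ 2 := linkDefect_eq_norm_sq (fun _ => g' x * (g x)⁻¹) ((0 : Site 4), (0 : Fin 4))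
  rw [hd]; exact sq_nonneg _

/-- The gauge distance from `1` to `pauliGauge H A` at an interior site dominates `(2/π)²‖A x‖²` (lower half of ✓T-S5.4j). -/
theorem sq_norm_le_gaugeDist_pauliGauge {H : ℕ} (A : ↥(interiorSites H) → EuclideanSpace ℝ (Fin 3)) (x : ↥(interiorSites H))
    (hA : ‖A x‖ ≤ Real.pi) : (2 / Real.pi) ^ 2 * ‖A x‖ ^ 2 ≤ gaugeDist (1 : Site 4 → SU2) (pauliGauge H A) x := by
  have hd : gaugeDist (1 : Site 4 → SU2) (pauliGauge H A) x = ‖su2Quat (pauliGauge H A x * ((1 : Site 4 → SU2) x)⁻¹) - 1‖ ^ 2 :=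
    linkDefect_eq_norm_sq (fun _ => pauliGauge H A x * ((1 : Site 4 → SU2) x)⁻¹) ((0 : Site 4), (0 : Fin 4))
  rw [hd, Pi.one_apply, inv_one, mul_one, pauliGauge_of_mem A x.2, ← mul_pow]
  have h := (pauliChartComparison (A x) hA).1
  have h0 : 0 ≤ 2 / Real.pi * ‖A x‖ := by positivity
  simpa using pow_le_pow_left₀ h0 h 2

end PauliRegions

open PauliRegions

/-! ## 4p -/

/-- **T-S5.4p, companion: the Pauli sup-box keeps the gauge ball** (`≤ (r₀ + 2ρ)²` on every box link). -/
theorem bulkLinkDefect : BulkLinkDefect := by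
  intro H r₀ ρ hr₀ hρ hρπ V A hV hA e he
  exact linkDefect_gaugeTransformZd_le_of_near_one hr₀ hV (norm_su2Quat_pauliGauge_sub_one_le hρ hρπ hA) he

/-- **T-S5.4p: on the Pauli sup-box the ball cut-off is identically `1`.** -/
theorem bulkCutoffOne : BulkCutoffOne := by
  intro H r₀ ρ r hr₀ hρ hρπ hr hle V A hV hA
  exact ballCutoff_gaugeTransformZd_eq_one_of_near_one hr₀ hρ hr hV (norm_su2Quat_pauliGauge_sub_one_le hρ hρπ hA) hle

/-! ## 4q -/

/-- **T-S5.4q: the far-region lower bound on `landauPhi`** (from ✓T-S5.4ℓ with `g := 1`, `g' := pauliGauge H A`; `c₀ = c₀(4ℓ)`,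
`c = c(4ℓ)·(2/π)²`). -/
theorem farRegionPhiLower : FarRegionPhiLower := by
  obtain ⟨c₀, c, hc₀, hc, hcoer⟩ := landauBallCoercivity
  refine ⟨c₀, c * (2 / Real.pi) ^ 2, hc₀, by positivity, ?_⟩
  intro H hH r₀ ρ₁ δ₁ hr₀ hρ₁ hρ₁π hδ₁ hrH V A hV hLV hA hx₀
  obtain ⟨x₀, hx₀⟩ := hx₀
  have hr : 0 ≤ r₀ + 2 * ρ₁ := by positivity
  -- the hypotheses of 4ℓ for `g := 1`, `g' := pauliGauge H A`, radius `r₀ + 2ρ₁`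
  have h1 : ∀ e ∈ boxEdges 4 (2 * H + 1), linkDefect (gaugeTransformZd (1 : Site 4 → SU2) V) e ≤ (r₀ + 2 * ρ₁) ^ 2 := by
    intro e he
    rw [gaugeTransformZd_one_eq_self]
    exact (hV e he).trans (pow_le_pow_left₀ hr₀ (by linarith) 2)
  have h2 : ∀ e ∈ boxEdges 4 (2 * H + 1), linkDefect (gaugeTransformZd (pauliGauge H A) V) e ≤ (r₀ + 2 * ρ₁) ^ 2 :=
    bulkLinkDefect H r₀ ρ₁ hr₀ hρ₁ hρ₁π V A hV hA
  have hL1 : InLandauGauge H (gaugeTransformZd (1 : Site 4 → SU2) V) := by rw [gaugeTransformZd_one_eq_self]; exact hLV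
  have key := hcoer H hH (r₀ + 2 * ρ₁) hr hrH V 1 (pauliGauge H A) (isInteriorGauge_one H) (isInteriorGauge_extendGauge _) h1 h2 hL1
  -- single out the site `x₀`
  have hsingle : gaugeDist (1 : Site 4 → SU2) (pauliGauge H A) x₀ ≤ ∑ x ∈ interiorSites H, gaugeDist (1 : Site 4 → SU2) (pauliGauge H A) x :=
    Finset.single_le_sum (fun x _ => gaugeDist_nonneg _ _ x) x₀.2
  have hx₀' := sq_norm_le_gaugeDist_pauliGauge A x₀ ((hA x₀).trans hρ₁π)
  have hδ : δ₁ ^ 2 ≤ ‖A x₀‖ ^ 2 := pow_le_pow_left₀ hδ₁ hx₀ 2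
  calc c * (2 / Real.pi) ^ 2 * δ₁ ^ 2 ≤ c * ((2 / Real.pi) ^ 2 * ‖A x₀‖ ^ 2) := by
        rw [mul_assoc]; exact mul_le_mul_of_nonneg_left (mul_le_mul_of_nonneg_left hδ (by positivity)) hc.le
    _ ≤ c * gaugeDist (1 : Site 4 → SU2) (pauliGauge H A) x₀ := mul_le_mul_of_nonneg_left hx₀' hc.le
    _ ≤ c * ∑ x ∈ interiorSites H, gaugeDist (1 : Site 4 → SU2) (pauliGauge H A) x := mul_le_mul_of_nonneg_left hsingle hc.le
    _ ≤ (H : ℝ) ^ 4 * landauPhi H (gaugeTransformZd (pauliGauge H A) V) := key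

end Summit.QuantumFields.YangMills.Theorems.AllWindowsColdBoxBoxHighLine

end
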